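import Literature.AlgebraicGeometry.HodgeTheory.ClassesSupportedOnComplexification
import Literature.AlgebraicGeometry.HodgeTheory.HodgeTypeConjugation

/-!
# Crux `HodgeAbelianVarieties` (stmt-HodgeConjecture-1333), line `cm-pivot-andre` — helper W4: the kernel component of a rational `(p, q)`-class

Helper W4 toward the registered stub `stub_andreSplitWeilCM` (André's decomposition with CM targets)
of the skeleton `Cruxes/HodgeAbelianVarieties/Lines/cm_pivot_andre.lean`. In the lead's construction
the `E`-Weil ("single-embedding") component of a rational `(p, p)`-class on `B = A ⊗ O_E` is cut out as
the joint KERNEL component of finitely many commuting endomorphisms `Q` of `Hᵏ(B(ℂ); ℂ)` which are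
`ℚ`-linear combinations of pull-backs along endomorphisms of `B` (so preserve rational classes and
Hodge types) and are diagonalisable (so `Hᵏ = ker Q ⊕ im Q`). This file is the ONE-operator step:

* `mem_range_of_ker_component` — the abstract linear algebra. Let `Q` be an endomorphism of a module
  `V` with `ker Q ∩ im Q = 0`, and `ι : W ↪ V` an additive embedding of a finite-dimensional vector
  space `W` (over any field `K`, `ι` semilinear for some `K → L`) with `Q (ι W) ⊆ ι W`. If `c ∈ ι W`
  decomposes as `c = a + b`, `Q a = 0`, `b ∈ im Q`, then `a ∈ ι W`. Proof: the restriction `Q₀` of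
  `Q` to `W` has `ker Q₀ ∩ im Q₀ = 0` (apply `ι`), hence `W = ker Q₀ ⊕ im Q₀` by rank–nullity
  (`Submodule.eq_top_of_disjoint`); decompose `c = ι (r₁ + r₂)` there and compare with `c = a + b`:
  `a - ι r₁ ∈ ker Q ∩ im Q = 0`.
* `isRationalClass_and_isOfHodgeType_of_ker_component` — for `X` smooth projective and
  `Q : Hᵏ(X(ℂ); ℂ) → Hᵏ(X(ℂ); ℂ)` complex linear, preserving rational classes and every Hodge type,
  with `ker Q ∩ im Q = 0`: in a decomposition `c = a + b`, `a ∈ ker Q`, `b ∈ im Q`, the kernel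
  component `a` is rational if `c` is (the abstract lemma for the `ℚ`-form
  `ι = ofRatClass : Hᵏ(X(ℂ); ℚ) ↪ Hᵏ(X(ℂ); ℂ)`, finite-dimensional by
  `finiteDimensional_bettiCohomology`, Voisin I §7.1.1) and of Hodge type `(p, q)` if `c` is (the
  abstract lemma for the complex subspace of classes of type `(p, q)` — `IsOfHodgeType.add/.smul`,
  Voisin I §7.1.1 — inside the finite-dimensional `Hᵏ(X(ℂ); ℂ) ≃ Hᵏ(X(ℂ); ℚ) ⊗ ℂ`,
  `ofRatClassBaseChangeEquiv`).

## References

* [VoisinHodgeI2002] C. Voisin, Hodge Theory and Complex Algebraic Geometry I, CUP 2002, §7.1.1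
  (`Hᵏ(X, ℚ) ⊗ ℂ = Hᵏ(X, ℂ)`; the `H^{p,q}` are complex subspaces), §11.3.2 (actions of
  correspondences preserve rational classes and Hodge types).
* [Andre1992] Y. André, Une remarque à propos des cycles de Hodge de type CM, Sém. Théorie des
  Nombres Paris 1989–90, Progr. Math. 102 (1992), 1–7.
-/

set_option linter.dupNamespace false

noncomputable section

namespace Summit.HodgeConjecture.HodgeConjecture.Theorems.HodgeAbelianVarieties.CMPivotAndre

open Literature.AlgebraicTopology.SingularHomology
open Literature.AlgebraicGeometry Literature.AlgebraicGeometry.HodgeTheory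

/-- **The kernel component of a vector of a `Q`-stable form lies in the form** (linear algebra).
Let `Q` be an `L`-linear endomorphism of `V` with `ker Q ⊓ im Q = ⊥`, `W` a finite-dimensional
`K`-vector space and `ι : W →+ V` injective, `K`-homogeneous for some `φ : K → L`, with
`Q (ι W) ⊆ ι W`. If `c = a + b` with `a ∈ ker Q`, `b ∈ im Q` and `c ∈ ι W`, then `a ∈ ι W`: the
restriction `Q₀ : W → W` of `Q` has `ker Q₀ ⊓ im Q₀ = ⊥`, so `W = ker Q₀ ⊕ im Q₀` by rank–nullity,
and the decomposition of `c` inside `W` agrees with `c = a + b` because `ker Q ⊓ im Q = ⊥`.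
[folklore] -/
theorem mem_range_of_ker_component {K L W V : Type*} [Field K] [AddCommGroup W] [Module K W]
    [FiniteDimensional K W] [Ring L] [AddCommGroup V] [Module L V]
    (φ : K → L) (ι : W →+ V) (hι : Function.Injective ι)
    (hιsmul : ∀ (t : K) (w : W), ι (t • w) = φ t • ι w)
    (Q : V →ₗ[L] V) (hQι : ∀ w : W, ∃ w' : W, ι w' = Q (ι w))
    (hdisj : Disjoint (LinearMap.ker Q) (LinearMap.range Q))
    {c a b : V} (ha : a ∈ LinearMap.ker Q) (hb : b ∈ LinearMap.range Q) (hc : c = a + b)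
    (hcι : c ∈ Set.range ι) : a ∈ Set.range ι := by
  choose f hf using hQι
  -- the restriction `Q₀` of `Q` to the `K`-form `W` (`ι ∘ Q₀ = Q ∘ ι`)
  let Q₀ : W →ₗ[K] W :=
    { toFun := f
      map_add' := fun x y ↦ hι (by simp only [hf, map_add])
      map_smul' := fun t x ↦ hι (by simp only [hf, RingHom.id_apply, hιsmul, map_smul]) }
  have hQ₀ : ∀ w, ι (Q₀ w) = Q (ι w) := hf
  -- `ι` maps `ker Q₀` into `ker Q` and `im Q₀` into `im Q`, so they are disjoint
  have hker : ∀ w ∈ LinearMap.ker Q₀, ι w ∈ LinearMap.ker Q := fun w hw ↦ by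
    rw [LinearMap.mem_ker] at hw ⊢
    rw [← hQ₀, hw, map_zero]
  have hran : ∀ w ∈ LinearMap.range Q₀, ι w ∈ LinearMap.range Q := fun w hw ↦ by
    obtain ⟨w', rfl⟩ := LinearMap.mem_range.1 hw
    exact LinearMap.mem_range.2 ⟨ι w', (hQ₀ w').symm⟩
  have hd₀ : Disjoint (LinearMap.ker Q₀) (LinearMap.range Q₀) := by
    refine Submodule.disjoint_def.2 fun w hw₁ hw₂ ↦ hι ?_
    rw [map_zero]
    exact Submodule.disjoint_def.1 hdisj _ (hker w hw₁) (hran w hw₂)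
  -- rank–nullity: `W = ker Q₀ ⊕ im Q₀`
  have htop : LinearMap.ker Q₀ ⊔ LinearMap.range Q₀ = ⊤ :=
    Submodule.eq_top_of_disjoint _ _
      (le_of_eq (by rw [add_comm, LinearMap.finrank_range_add_finrank_ker])) hd₀
  -- decompose `c = ι r` inside `W` and compare with `c = a + b`
  obtain ⟨r, hr⟩ := hcι
  have hr' : r ∈ LinearMap.ker Q₀ ⊔ LinearMap.range Q₀ := by
    rw [htop]
    exact Submodule.mem_top
  obtain ⟨r₁, hr₁, r₂, hr₂, rfl⟩ := Submodule.mem_sup.1 hr'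
  refine ⟨r₁, ?_⟩
  have h₁ : a - ι r₁ ∈ LinearMap.ker Q := Submodule.sub_mem _ ha (hker r₁ hr₁)
  have h₂ : a - ι r₁ ∈ LinearMap.range Q := by
    have e : a - ι r₁ = ι r₂ - b := by
      rw [sub_eq_sub_iff_add_eq_add, ← hc, ← hr, map_add, add_comm]
    rw [e]
    exact Submodule.sub_mem _ (hran r₂ hr₂) hb
  have h₀ : a - ι r₁ = 0 := Submodule.disjoint_def.1 hdisj _ h₁ h₂
  exact (sub_eq_zero.1 h₀).symm

/-- **The kernel component of a rational `(p, q)`-class is rational and of type `(p, q)`** (helper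
W4 of line `cm-pivot-andre`). For `X` smooth projective of dimension `n`, a complex-linear
`Q : Hᵏ(X(ℂ); ℂ) → Hᵏ(X(ℂ); ℂ)` which maps rational classes to rational classes and classes of type
`(p, q)` to classes of type `(p, q)` (e.g. a `ℚ`-combination of pull-backs along endomorphisms,
Voisin I §11.3.2), with `ker Q ⊓ im Q = ⊥`, and a decomposition `c = a + b`, `a ∈ ker Q`,
`b ∈ im Q`: if `c` is rational then so is `a` (`mem_range_of_ker_component` for the `ℚ`-form
`ofRatClass : Hᵏ(X(ℂ); ℚ) ↪ Hᵏ(X(ℂ); ℂ)`, injective and with image the rational classes, `Hᵏ(X(ℂ); ℚ)`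
finite-dimensional); if `c` is of type `(p, q)` then so is `a` (`mem_range_of_ker_component` for the
`Q`-stable complex subspace of classes of type `(p, q)` of the finite-dimensional
`Hᵏ(X(ℂ); ℂ) ≃ Hᵏ(X(ℂ); ℚ) ⊗ ℂ`). [cite: VoisinHodgeI2002, §7.1.1] -/
theorem isRationalClass_and_isOfHodgeType_of_ker_component : ∀ {n : ℕ} {X : Literature.AlgebraicGeometry.Motives.SchemeOver ℂ}, Literature.AlgebraicGeometry.Motives.IsSmoothProjective n X → ∀ {k : ℕ} (Q : Literature.AlgebraicGeometry.HodgeTheory.complexBetti X k →ₗ[ℂ] Literature.AlgebraicGeometry.HodgeTheory.complexBetti X k), (∀ c, Literature.AlgebraicGeometry.HodgeTheory.IsRationalClass c → Literature.AlgebraicGeometry.HodgeTheory.IsRationalClass (Q c)) → (∀ (p q : ℕ) c, Literature.AlgebraicGeometry.HodgeTheory.IsOfHodgeType n X k p q c → Literature.AlgebraicGeometry.HodgeTheory.IsOfHodgeType n X k p q (Q c)) → Disjoint (LinearMap.ker Q) (LinearMap.range Q) → ∀ (c a b : Literature.AlgebraicGeometry.HodgeTheory.complexBetti X k), a ∈ LinearMap.ker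 Q → b ∈ LinearMap.range Q → c = a + b → (Literature.AlgebraicGeometry.HodgeTheory.IsRationalClass c → Literature.AlgebraicGeometry.HodgeTheory.IsRationalClass a) ∧ (∀ p q : ℕ, Literature.AlgebraicGeometry.HodgeTheory.IsOfHodgeType n X k p q c → Literature.AlgebraicGeometry.HodgeTheory.IsOfHodgeType n X k p q a) := by
  intro n X hX k Q hQrat hQhodge hdisj c a b ha hb hc
  haveI : FiniteDimensional ℚ (Motives.bettiCohomology X k) := finiteDimensional_bettiCohomology hX k
  refine ⟨fun hcrat ↦ ?_, fun p q hcH ↦ ?_⟩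
  · -- the `ℚ`-form `ι = ofRatClass : Hᵏ(X(ℂ); ℚ) ↪ Hᵏ(X(ℂ); ℂ)`
    have h := mem_range_of_ker_component (fun t : ℚ ↦ (t : ℂ))
      (ofRatClass (Motives.ComplexPoints X) k) (ofRatClass_injective k)
      (Motives.ofRatClass_smul (Motives.ComplexPoints X) k) Q
      (fun w ↦ (isRationalClass_iff_mem_range_ofRatClass _).1
        (hQrat _ (isRationalClass_ofRatClass w)))
      hdisj ha hb hc ((isRationalClass_iff_mem_range_ofRatClass c).1 hcrat)
    exact (isRationalClass_iff_mem_range_ofRatClass a).2 h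
  · -- the complex subspace of classes of type `(p, q)`, inside the finite-dimensional `Hᵏ(X(ℂ); ℂ)`
    haveI : FiniteDimensional ℂ (complexBetti X k) :=
      LinearEquiv.finiteDimensional (ofRatClassBaseChangeEquiv hX k)
    obtain ⟨A, -⟩ := id hcH
    let W : Submodule ℂ (complexBetti X k) :=
      { carrier := {x | IsOfHodgeType n X k p q x}
        add_mem' := fun hx hy ↦ hx.add hX hy
        zero_mem' := IsOfHodgeType.zero A k p q
        smul_mem' := fun t x hx ↦ IsOfHodgeType.smul hx t }
    have h := mem_range_of_ker_component (fun t : ℂ ↦ t) W.subtype.toAddMonoidHom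
      W.injective_subtype (fun _ _ ↦ rfl) Q
      (fun w ↦ ⟨⟨Q w, hQhodge p q w w.2⟩, rfl⟩) hdisj ha hb hc ⟨⟨c, hcH⟩, rfl⟩
    obtain ⟨w, hw⟩ := h
    rw [← hw]
    exact w.2

end Summit.HodgeConjecture.HodgeConjecture.Theorems.HodgeAbelianVarieties.CMPivotAndre

end
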